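import Summits.QuantumAdvantage.QuantumAdvantage.Theorems.RankDialG1
import HarnessLib

/-!
# RankDial (G2) — §15 the junta law for linear tests (`WindowJuntaLinSel p` PROVED, residual `WindowWideLinSel p s`), §16 junta windows of full rank (`coordY`), §17 `degree_dial`

TARGET BY NAME (cell decomp-qadv, RESIDUAL MODE): item stmt-QuantumAdvantage-23109
`Summit.QuantumAdvantage.QuantumAdvantage.Theses.OddPrimeWalk.ManyReadersSqrtOdd`, through rung R5 = `AdviceFreeQNC0.WalkHardFLinSel p`.
This file SUPPORTS the item (`--supports`); it does not close it.  Declaration bodies are byte-identical to the cell node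
«DegreeDial» (decomp-qadv lens-1, generation 26, part G; node file RankDialG.lean), cut into ≤ 400-line parts
G1 (§13 junta lemma, §14 degree fibre theorem, `WindowDegSel`) → G2 (§15 junta law / wide residual, §16 `coordY` strictness, §17 `degree_dial`);
see part G1 for the whole node.
-/

set_option linter.dupNamespace false
set_option autoImplicit false

noncomputable section
open Classical

namespace Summit.QuantumAdvantage.QuantumAdvantage.Theorems.RankDial

open Finset
open Summit.QuantumAdvantage.AdviceFreeQNC0
open Literature.Computability.MetaComplexity Literature.Computability.MetaComplexity.Smolensky

/-! ### §15 The junta law for linear tests and the wide-reader residual -/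

section LinJunta
variable {p : ℕ} [Fact p.Prime] {L ℓ R : ℕ}

/-- The WINDOW SUPPORT of cut `g`'s linear form: the window coordinates with a non-zero coefficient. -/
def wsupp (lam : Fin (L + ℓ + R + 1) → Fin (L + ℓ + R) → ZMod p) (g : Fin (L + ℓ + R + 1)) : Finset (Fin ℓ) :=
  univ.filter fun j => lamW lam g j ≠ 0

/-- A linear-test selector on a fibre depends only on the window support of its form, hence has `𝔽₂`-degree
`≤ #wsupp` (junta lemma) — WHATEVER the modulus `p` and the rank. -/
theorem fireFn_mem_lowDeg_wsupp (y : Fin (L + ℓ + R + 1) → (Fin (L + ℓ + R) → Bool) → Bool)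
    (lam : Fin (L + ℓ + R + 1) → Fin (L + ℓ + R) → ZMod p) (rr : Fin (L + ℓ + R + 1) → ZMod p)
    (hyl : ∀ g u, y g u = decide ((∑ i, if u i then lam g i else 0) = rr g))
    (g : Fin (L + ℓ + R + 1)) (a : Fin L → Bool) (b : Fin R → Bool) :
    fireFn y a b g ∈ lowDeg (ZMod 2) ℓ (wsupp lam g).card := by
  refine junta_mem_lowDeg (wsupp lam g) _ fun v w hvw => ?_
  have hsum : (∑ j, if v j then lamW lam g j else 0) = ∑ j, if w j then lamW lam g j else 0 := by
    refine Finset.sum_congr rfl fun j _ => ?_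
    by_cases hj : j ∈ wsupp lam g
    · rw [hvw j hj]
    · have h0 : lamW lam g j = 0 := by simpa [wsupp] using hj
      simp [h0]
  simp only [fireFn, linSel_glue3 y lam rr hyl g a v b, linSel_glue3 y lam rr hyl g a w b, hsum]

/-- Window supports `≤ s` ⟹ degree grade `≤ s`. -/
theorem degLE_of_wsupp_le (y : Fin (L + ℓ + R + 1) → (Fin (L + ℓ + R) → Bool) → Bool)
    (lam : Fin (L + ℓ + R + 1) → Fin (L + ℓ + R) → ZMod p) (rr : Fin (L + ℓ + R + 1) → ZMod p)
    (hyl : ∀ g u, y g u = decide ((∑ i, if u i then lam g i else 0) = rr g)) {s : ℕ}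
    (hs : ∀ g, (wsupp lam g).card ≤ s) : DegLE y s :=
  fun g a b => lowDeg_mono (hs g) (fireFn_mem_lowDeg_wsupp y lam rr hyl g a b)

/-- Contrapositive: a window NOT of degree grade `≤ s` has, in EVERY linear representation, a cut of window support
`> s` (a WIDE reader). -/
theorem exists_wide_of_not_degLE (y : Fin (L + ℓ + R + 1) → (Fin (L + ℓ + R) → Bool) → Bool)
    (lam : Fin (L + ℓ + R + 1) → Fin (L + ℓ + R) → ZMod p) (rr : Fin (L + ℓ + R + 1) → ZMod p)
    (hyl : ∀ g u, y g u = decide ((∑ i, if u i then lam g i else 0) = rr g)) {s : ℕ} (h : ¬ DegLE y s) :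
    ∃ g, s < (wsupp lam g).card := by
  by_contra hne
  exact h (degLE_of_wsupp_le y lam rr hyl fun g => not_lt.1 fun hlt => hne ⟨g, hlt⟩)

variable (p)

/-- **PIECE `WindowJuntaLinSel p`** (the junta grade, linear tests): for every `s`, a linear-test strategy with a
cut-free window of length `≥ ℓ₀(s)` in which EVERY cut's form has window support `≤ s` wins on `≤ θ·2ⁿ` inputs.
[NECESSARY (`windowJunta_of_r5`) · STRICTLY WEAKER than R5 · NOT implied by the rank grade (§16: junta windows of full
rank) · **PROVED for every prime `p`**: `windowJuntaLinSel_holds` (`θ = 11/12`).] -/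
def WindowJuntaLinSel : Prop :=
  ∀ s : ℕ, ∃ θ : ℝ, θ < 1 ∧ ∃ ℓ₀ : ℕ, ∀ L ℓ R : ℕ, ℓ₀ ≤ ℓ →
    ∀ (c : ℕ) (y : Fin (L + ℓ + R + 1) → (Fin (L + ℓ + R) → Bool) → Bool)
      (lam : Fin (L + ℓ + R + 1) → Fin (L + ℓ + R) → ZMod p) (rr : Fin (L + ℓ + R + 1) → ZMod p),
      (∀ g u, y g u = decide ((∑ i, if u i then lam g i else 0) = rr g)) → CutFree y L ℓ →
      (∀ g, (wsupp lam g).card ≤ s) →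
      ((univ.filter fun u : Fin (L + ℓ + R) → Bool => ringWinU c y u = true).card : ℝ) ≤ θ * (2 : ℝ) ^ (L + ℓ + R)

/-- The degree law implies the junta law. -/
theorem windowJunta_of_degSel (h : WindowDegSel) : WindowJuntaLinSel p := by
  intro s
  obtain ⟨θ, hθ, ℓ₀, h⟩ := h s
  exact ⟨θ, hθ, ℓ₀, fun L ℓ R hℓ c y lam rr hyl hgap hs => h L ℓ R hℓ c y hgap (degLE_of_wsupp_le y lam rr hyl hs)⟩

/-- **THE JUNTA LAW IS A THEOREM** for every prime `p` (`θ = 11/12`, `ℓ₀ = 4(s+2)4^s`). -/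
theorem windowJuntaLinSel_holds : WindowJuntaLinSel p :=
  windowJunta_of_degSel p windowDegSel_holds

/-- NECESSARY: rung R5 implies the junta piece (sanity: the piece is a consequence of the target). -/
theorem windowJunta_of_r5 (h : WalkHardFLinSel p) : WindowJuntaLinSel p := by
  intro s
  obtain ⟨θ, hθ, n₀, h⟩ := h
  refine ⟨θ, hθ, n₀, fun L ℓ R hℓ c y lam rr hyl _ _ => ?_⟩
  exact h (L + ℓ + R) (by omega) c y fun g => ⟨lam g, rr g, hyl g⟩

/-- **PIECE `WindowWideLinSel p s`** (the residual of the high-rank piece after the degree law): `WindowHighRankLinSel p`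
restricted to windows that are NOT of degree grade `≤ s` — under `LinSel`, windows with a WIDE reader (a cut whose form
has window support `> s` in every representation, `exists_wide_of_not_degLE`).  [NECESSARY (`wide_of_highRank`,
`wide_of_r5`) · with the degree law EQUIVALENT to the high-rank piece (`highRank_iff_wide`) · IDEA-NEEDED; why it might
fail as a route: it still contains every long-window strategy with one wide reader of full rank.] -/
def WindowWideLinSel (s : ℕ) : Prop :=
  ∀ E : ℕ, 0 < E → ∃ θ : ℝ, θ < 1 ∧ ∃ C : ℕ, ∃ n₀ : ℕ, ∀ L ℓ R : ℕ, n₀ ≤ L + ℓ + R →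
    C * (Nat.log 2 (L + ℓ + R) + 1) ≤ ℓ →
    ∀ (c : ℕ) (y : Fin (L + ℓ + R + 1) → (Fin (L + ℓ + R) → Bool) → Bool), LinSel p y → CutFree y L ℓ →
      ¬ RankLE p y (ℓ / E) → ¬ DegLE y s →
      ((univ.filter fun u : Fin (L + ℓ + R) → Bool => ringWinU c y u = true).card : ℝ) ≤ θ * (2 : ℝ) ^ (L + ℓ + R)

/-- NECESSARY: the high-rank piece implies the wide piece (drop a hypothesis). -/
theorem wide_of_highRank (s : ℕ) (h : WindowHighRankLinSel p) : WindowWideLinSel p s := by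
  intro E hE
  obtain ⟨θ, hθ, C, n₀, h⟩ := h E hE
  exact ⟨θ, hθ, C, n₀, fun L ℓ R hn hC c y hy hgap hr _ => h L ℓ R hn hC c y hy hgap hr⟩

/-- **The degree law shrinks the residual**: degree law ∧ wide piece ⟹ high-rank piece. -/
theorem highRank_of_deg_wide (s : ℕ) (hD : WindowDegSel) (hW : WindowWideLinSel p s) : WindowHighRankLinSel p := by
  intro E hE
  obtain ⟨θ₁, hθ₁, C₁, n₁, hW⟩ := hW E hE
  obtain ⟨θ₂, hθ₂, ℓ₀, hD⟩ := hD s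
  refine ⟨max θ₁ θ₂, max_lt hθ₁ hθ₂, max C₁ ℓ₀, n₁, fun L ℓ R hn hC c y hy hgap hr => ?_⟩
  have hlog : 1 ≤ Nat.log 2 (L + ℓ + R) + 1 := Nat.le_add_left 1 _
  have hC₁ : C₁ * (Nat.log 2 (L + ℓ + R) + 1) ≤ ℓ :=
    le_trans (Nat.mul_le_mul_right _ (le_max_left C₁ ℓ₀)) hC
  have hℓ₀ : ℓ₀ ≤ ℓ := by
    have h1 : ℓ₀ ≤ max C₁ ℓ₀ * (Nat.log 2 (L + ℓ + R) + 1) :=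
      le_trans (le_max_right C₁ ℓ₀) (Nat.le_mul_of_pos_right _ hlog)
    exact le_trans h1 hC
  have hpos : (0 : ℝ) ≤ (2 : ℝ) ^ (L + ℓ + R) := by positivity
  by_cases hdeg : DegLE y s
  · exact le_trans (hD L ℓ R hℓ₀ c y hgap hdeg) (mul_le_mul_of_nonneg_right (le_max_right θ₁ θ₂) hpos)
  · exact le_trans (hW L ℓ R hn hC₁ c y hy hgap hr hdeg) (mul_le_mul_of_nonneg_right (le_max_left θ₁ θ₂) hpos)

/-- With the degree law a theorem, the wide piece IS the high-rank piece (for every `s`). -/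
theorem highRank_iff_wide (s : ℕ) : WindowHighRankLinSel p ↔ WindowWideLinSel p s :=
  ⟨wide_of_highRank p s, highRank_of_deg_wide p s windowDegSel_holds⟩

/-- **Residual of rung R5 after the degree law** (`p ≥ 5`, any `s`): wide-reader windows and the no-window core. -/
theorem r5_residual_wide (hp : 5 ≤ p) (s : ℕ) (hW : WindowWideLinSel p s) (hN : NoWindowLinSel p) :
    WalkHardFLinSel p :=
  r5_residual hp (highRank_of_deg_wide p s windowDegSel_holds hW) hN

end LinJunta

/-! ### §16 Strictness: junta windows of FULL rank — the junta law lives where no window-only law can -/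

section Coord
variable (p : ℕ) [Fact p.Prime] (ℓ : ℕ)

/-- The forms of the COORDINATE-READER strategy on `n = 0 + ℓ + ℓ` bits: cut `ℓ + i` (`i < ℓ`) has form `e_i`
(window coordinate `i`), every other cut the zero form. -/
def coordLam (g : Fin (0 + ℓ + ℓ + 1)) (i : Fin (0 + ℓ + ℓ)) : ZMod p :=
  if h : ℓ ≤ g.val ∧ g.val < ℓ + ℓ then
    (if i = Fin.castAdd ℓ (Fin.natAdd 0 ⟨g.val - ℓ, by omega⟩) then 1 else 0)
  else 0

/-- The coordinate-reader strategy: cut `g` fires iff `coordLam g · u = 1` (cut `ℓ + i` fires iff bit `i` is set;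
all other cuts never fire). -/
def coordY (g : Fin (0 + ℓ + ℓ + 1)) (u : Fin (0 + ℓ + ℓ) → Bool) : Bool :=
  decide ((∑ i, if u i then coordLam p ℓ g i else 0) = 1)

/-- `coordY` is a linear-test strategy. -/
theorem coordY_linSel : LinSel p (coordY p ℓ) := fun g => ⟨coordLam p ℓ g, 1, fun _ => rfl⟩

/-- its explicit representation -/
theorem coordY_hyl : ∀ g u, coordY p ℓ g u = decide ((∑ i, if u i then coordLam p ℓ g i else 0) = (fun _ => (1 : ZMod p)) g) :=
  fun _ _ => rfl

/-- The window `[0, ℓ)` of `coordY` is cut-free (interior cuts have the zero form and target `1 ≠ 0`). -/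
theorem coordY_cutFree : CutFree (coordY p ℓ) 0 ℓ := by
  intro g _ hg u
  have h0 : ∀ i, coordLam p ℓ g i = 0 := fun i => by
    unfold coordLam
    rw [dif_neg (by omega)]
  simp only [coordY, h0, ite_self, Finset.sum_const_zero, decide_eq_false_iff_not]
  exact zero_ne_one

/-- Every cut of `coordY` has window support `≤ 1`. -/
theorem coordY_wsupp_le_one (g : Fin (0 + ℓ + ℓ + 1)) : (wsupp (coordLam p ℓ) g).card ≤ 1 := by
  refine Finset.card_le_one.2 fun j hj j' hj' => ?_
  simp only [wsupp, Finset.mem_filter, Finset.mem_univ, true_and, lamW, coordLam] at hj hj'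
  by_cases h : ℓ ≤ g.val ∧ g.val < ℓ + ℓ
  · rw [dif_pos h] at hj hj'
    have e : ∀ k : Fin ℓ, (if Fin.castAdd ℓ (Fin.natAdd 0 k) = Fin.castAdd ℓ (Fin.natAdd 0 ⟨g.val - ℓ, by omega⟩)
        then (1 : ZMod p) else 0) ≠ 0 → k.val = g.val - ℓ := by
      intro k hk
      by_contra hne
      apply hk
      rw [if_neg]
      intro heq
      apply hne
      have hv := congrArg Fin.val heq
      rw [Fin.val_castAdd, Fin.val_natAdd, Fin.val_castAdd, Fin.val_natAdd] at hv
      simpa using hv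
    exact Fin.ext ((e j hj).trans (e j' hj').symm)
  · rw [dif_neg h] at hj
    exact absurd rfl hj

/-- Cut `ℓ + i` of `coordY` reads exactly bit `i` of the window. -/
theorem coordY_reader (i : Fin ℓ) (a : Fin 0 → Bool) (v : Fin ℓ → Bool) (b : Fin ℓ → Bool) :
    coordY p ℓ ⟨ℓ + i.val, by omega⟩ (glue3 a v b) = v i := by
  have hidx : (⟨ℓ + i.val - ℓ, by omega⟩ : Fin ℓ) = i := Fin.ext (by simp)
  have hlam : ∀ k : Fin (0 + ℓ + ℓ), coordLam p ℓ ⟨ℓ + i.val, by omega⟩ k =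
      if k = Fin.castAdd ℓ (Fin.natAdd 0 i) then 1 else 0 := by
    intro k
    unfold coordLam
    rw [dif_pos ⟨by simp, by simp [i.isLt]⟩]
    simp only [hidx]
  unfold coordY
  simp only [hlam]
  have hsum : (∑ k : Fin (0 + ℓ + ℓ), if glue3 a v b k then (if k = Fin.castAdd ℓ (Fin.natAdd 0 i) then (1 : ZMod p)
      else 0) else 0) = if v i then 1 else 0 := by
    rw [Finset.sum_eq_single (Fin.castAdd ℓ (Fin.natAdd 0 i))]
    · have hg : glue3 a v b (Fin.castAdd ℓ (Fin.natAdd 0 i)) = v i := by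
        simp only [glue3, Fin.append_left, Fin.append_right]
      rw [hg, if_pos rfl]
    · intro k _ hk
      rw [if_neg hk, ite_self]
    · intro h
      exact absurd (Finset.mem_univ _) h
  rw [hsum]
  cases v i
  · rw [if_neg Bool.false_ne_true, decide_eq_false_iff_not]
    exact zero_ne_one
  · rw [if_pos rfl, decide_eq_true_iff]

/-- **Junta windows escape every rank bound**: if `p^d < 2^ℓ` the window view of `coordY` has sketch dimension `> d`
(a sketch through which all `ℓ` coordinates factor is injective on `{0,1}^ℓ`). -/
theorem coordY_not_rankLE {d : ℕ} (hd : p ^ d < 2 ^ ℓ) : ¬ RankLE p (coordY p ℓ) d := by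
  rintro ⟨d', hd', Φ, hT⟩
  let a₀ : Fin 0 → Bool := fun k => k.elim0
  let b₀ : Fin ℓ → Bool := fun _ => false
  have key : ∀ i : Fin ℓ, ∃ T : (Fin d' → ZMod p) → Bool, ∀ v : Fin ℓ → Bool,
      v i = T (fun k => ∑ j, if v j then Φ k j else 0) := by
    intro i
    obtain ⟨T, hT'⟩ := hT ⟨ℓ + i.val, by omega⟩ a₀ b₀
    exact ⟨T, fun v => by rw [← coordY_reader p ℓ i a₀ v b₀]; exact hT' v⟩
  choose T hT using key
  have hinj : Function.Injective fun (v : Fin ℓ → Bool) (k : Fin d') => ∑ j, if v j then Φ k j else 0 := by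
    intro v w hvw
    funext i
    rw [hT i v, hT i w]
    exact congrArg (T i) hvw
  have hcard := Fintype.card_le_of_injective _ hinj
  simp only [Fintype.card_fun, Fintype.card_bool, Fintype.card_fin, ZMod.card] at hcard
  have hmono : p ^ d' ≤ p ^ d := Nat.pow_le_pow_right (Fact.out : p.Prime).pos hd'
  omega

/-- `p < 2^{p−1}` for `p ≥ 3`. -/
theorem lt_two_pow_pred {p : ℕ} (hp : 3 ≤ p) : p < 2 ^ (p - 1) := by
  have h1 : p - 2 < 2 ^ (p - 2) := Nat.lt_two_pow_self
  have h2 : 2 ^ (p - 1) = 2 * 2 ^ (p - 2) := by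
    rw [show p - 1 = (p - 2) + 1 by omega, pow_succ]
    ring
  omega

/-- **In particular above the ceiling of every window-only law**: for `p ≥ 3` and `ℓ ≥ 1` the junta window of `coordY`
has rank `> ℓ/(p−1)` — the regime where `not_equiRank_block` / `not_massRank_block` (parts D, F) show that no law
uniform in the tables can hold; the junta law (§15) decides it. -/
theorem coordY_not_rankLE_div (hp : 3 ≤ p) (hℓ : 1 ≤ ℓ) : ¬ RankLE p (coordY p ℓ) (ℓ / (p - 1)) := by
  refine coordY_not_rankLE p ℓ ?_
  rcases Nat.eq_zero_or_pos (ℓ / (p - 1)) with hq | hq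
  · rw [hq, pow_zero]
    exact Nat.one_lt_two_pow (by omega)
  · calc p ^ (ℓ / (p - 1)) < (2 ^ (p - 1)) ^ (ℓ / (p - 1)) :=
          Nat.pow_lt_pow_left (lt_two_pow_pred hp) (by omega)
      _ = 2 ^ ((p - 1) * (ℓ / (p - 1))) := by rw [pow_mul]
      _ ≤ 2 ^ ℓ := Nat.pow_le_pow_right (by norm_num) (Nat.mul_div_le ℓ (p - 1))

/-- **Summary of the strictness witness**: a linear-test strategy (`coordY`) with a cut-free window on which every cut
has window support `≤ 1` — so inside the junta law for `s = 1` — but window rank above `ℓ/(p−1)` (`p ≥ 3`, `ℓ ≥ 1`). -/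
theorem junta_window_beyond_rank (hp : 3 ≤ p) (hℓ : 1 ≤ ℓ) :
    LinSel p (coordY p ℓ) ∧ CutFree (coordY p ℓ) 0 ℓ ∧ (∀ g, (wsupp (coordLam p ℓ) g).card ≤ 1) ∧
      ¬ RankLE p (coordY p ℓ) (ℓ / (p - 1)) :=
  ⟨coordY_linSel p ℓ, coordY_cutFree p ℓ, coordY_wsupp_le_one p ℓ, coordY_not_rankLE_div p ℓ hp hℓ⟩

end Coord

/-! ### §17 The degree dial in one display -/

section Dial
variable (p : ℕ) [Fact p.Prime]

/-- **THE DEGREE DIAL** (generation 26, part G).  (i) the degree law for arbitrary tables (`WindowDegSel`, every `s`,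
`θ = 11/12`, `ℓ ≥ 4(s+2)4^s`); (ii) the junta law for linear tests at every prime (`WindowJuntaLinSel p`);
(iii) the junta piece is NECESSARY for R5; (iv) the residual of R5 (`p ≥ 5`) is `WindowWideLinSel p s ∧ NoWindowLinSel p`
for any `s`; (v) the junta law is not a rank law: junta windows of rank `> ℓ/(p−1)` exist for every `ℓ ≥ 1` (`p ≥ 3`). -/
theorem degree_dial (hp : 5 ≤ p) :
    WindowDegSel ∧ WindowJuntaLinSel p ∧ (WalkHardFLinSel p → WindowJuntaLinSel p) ∧
      (∀ s, WindowWideLinSel p s → NoWindowLinSel p → WalkHardFLinSel p) ∧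
      (∀ ℓ, 1 ≤ ℓ → ∃ y : Fin (0 + ℓ + ℓ + 1) → (Fin (0 + ℓ + ℓ) → Bool) → Bool,
        LinSel p y ∧ CutFree y 0 ℓ ∧ DegLE y 1 ∧ ¬ RankLE p y (ℓ / (p - 1))) :=
  ⟨windowDegSel_holds, windowJuntaLinSel_holds p, windowJunta_of_r5 p, fun s hW hN => r5_residual_wide p hp s hW hN,
    fun ℓ hℓ => ⟨coordY p ℓ, coordY_linSel p ℓ, coordY_cutFree p ℓ,
      degLE_of_wsupp_le (coordY p ℓ) (coordLam p ℓ) (fun _ => 1) (coordY_hyl p ℓ) (coordY_wsupp_le_one p ℓ),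
      coordY_not_rankLE_div p ℓ (by omega) hℓ⟩⟩

end Dial

end Summit.QuantumAdvantage.QuantumAdvantage.Theorems.RankDial

end
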